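import Mathlib

/-!
# Route `ElementaryWordLength`, item `VpWordQp` (stmt-ValiantsHypothesis-6628) — part 1:
the word algebra of affine elementary words in `E_3(k[x])`

Helper file (`--supports stmt-ValiantsHypothesis-6628`) for
`Summits/ValiantsHypothesis/ValiantsHypothesis/Theorems/ElementaryWordLengthVpWordQp.lean`, which
proves `Summit.ValiantsHypothesis.ValiantsHypothesis.Theses.ElementaryWordLength.VpWordQp`
(every `VP` family has affine elementary words of quasi-polynomial length).

A *letter* is `l : Fin 3 × Fin 3 × k × Option σ`, read as the elementary matrix
`E_{l.1 l.2.1}(λ)` (`l.2.2.2 = none`) or `E_{l.1 l.2.1}(λ · x_s)` (`l.2.2.2 = some s`), `λ = l.2.2.1`,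
i.e. `Matrix.transvection l.1 l.2.1 (C λ * l.2.2.2.elim 1 X)` over `MvPolynomial σ k`, exactly as
in the route file; a *word* is a list of letters with `l.1 ≠ l.2.1`, its matrix `wprod⟦w⟧` the
product. `HasWordAt[i, j, g, m]` — a LOCAL NOTATION (deliberately not a definition, as in
`DivisionGapZeroOneTransferFormulaToIMM.lean`) — says that `E_{ij}(g)` is the matrix of a word of
length `≤ m`. This file proves the Ben-Or–Cleve register algebra [BenOrCleve1992, Thm. 1] in
this language, at every off-diagonal position `(i, j)` of `SL_3` simultaneously (so that no
conjugation by monomial matrices is ever needed):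

* `hasWordAt_add`: sums are concatenations, `E_{ij}(g₁) E_{ij}(g₂) = E_{ij}(g₁ + g₂)`;
* `wprod_winv`: the reversed word with negated scalars is a two-sided inverse;
* `transvection_comm`, `hasWordAt_mul`: products are Steinberg commutators
  `E_{ij}(f) E_{jl}(g) E_{ij}(-f) E_{jl}(-g) = E_{il}(fg)` (`i, j, l` distinct), length
  `2m₁ + 2m₂`; `hasWordAt_mul_all` routes through the third index `-(p + q)` of `Fin 3`;
* `hasWordAt_list_sum`, `hasWordAt_finset_sum`, `hasWordAt_list_prod` (`n` factors of length
  `≤ b` ↦ length `≤ 4ⁿ (b + 1)`);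
* `hasWordAt_of_totalDegree_le_one`: an affine linear form over a finite variable set `σ` is
  `a₀ + ∑ₛ aₛ xₛ` (`eq_C_add_sum_of_totalDegree_le_one`), a word of `#σ + 1` letters.

Everything over an arbitrary commutative ring `k` and variable type `σ` (finite only for the
affine letters). Unconditional (axioms `propext`, `Classical.choice`, `Quot.sound`).
References: [BenOrCleve1992] M. Ben-Or, R. Cleve, *Computing algebraic formulas using a constant
number of registers*, SIAM J. Comput. 21 (1992), Thm. 1; [BurgisserClausenShokrollahi1997]
P. Bürgisser, M. Clausen, M. A. Shokrollahi, *Algebraic Complexity Theory*, §21.5.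
-/

set_option linter.dupNamespace false

namespace Summit.ValiantsHypothesis.ValiantsHypothesis.Theorems

open Matrix MvPolynomial

/-- `wprod⟦w⟧` (local notation, not a definition): the matrix of a word `w`, the product of the
elementary letters `E_{ij}(λ)` / `E_{ij}(λ x_s)` it lists. -/
local notation3 (prettyPrint := false) "wprod⟦" w "⟧" => List.prod (List.map (fun l =>
  Matrix.transvection l.1 l.2.1 (MvPolynomial.C l.2.2.1 * l.2.2.2.elim 1 MvPolynomial.X)) w)

/-- `winv⟦w⟧` (local notation, not a definition): the inverse word (reverse the letters and
negate their scalars). -/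
local notation3 (prettyPrint := false) "winv⟦" w "⟧" =>
  List.reverse (List.map (fun l => (l.1, l.2.1, -l.2.2.1, l.2.2.2)) w)

/-- `HasWordAt[i, j, g, m]` (local notation, not a definition): the transvection `E_{ij}(g)` is
the matrix of a word of at most `m` off-diagonal elementary letters. -/
local notation3 (prettyPrint := false) "HasWordAt[" i ", " j ", " g ", " m "]" =>
  ∃ w : List (Fin 3 × Fin 3 × _ × Option _), List.length w ≤ m ∧ (∀ l ∈ w, l.1 ≠ l.2.1) ∧
    wprod⟦w⟧ = Matrix.transvection i j g

namespace VpWordQp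

/-! ## The word algebra in `E_3(k[x])` -/

section Words

variable {k : Type*} [CommRing k] {σ : Type*}

/-- **Steinberg relation** `[E_{ij}(a), E_{jl}(b)] = E_{il}(ab)` for distinct `i, j, l`, written
as a product of four transvections. [folklore] -/
theorem transvection_comm {n R : Type*} [Fintype n] [DecidableEq n] [CommRing R] {i j l : n}
    (hij : i ≠ j) (hjl : j ≠ l) (hil : i ≠ l) (a b : R) :
    transvection i j a * transvection j l b * transvection i j (-a) * transvection j l (-b) =
      transvection i l (a * b) := by
  have h1 : ∀ (c d : R) (x : n), single i j c * single i x d = 0 := fun c d x =>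
    single_mul_single_of_ne c i j i hij.symm d
  have h2 : ∀ (c d : R) (x : n), single j l c * single j x d = 0 := fun c d x =>
    single_mul_single_of_ne c j l j hjl.symm d
  have h3 : ∀ (c d : R) (x : n), single j l c * single i x d = 0 := fun c d x =>
    single_mul_single_of_ne c j l i hil.symm d
  have h4 : ∀ (c d : R) (x : n), single i l c * single i x d = 0 := fun c d x =>
    single_mul_single_of_ne c i l i hil.symm d
  have h5 : ∀ (c d : R) (x : n), single i l c * single j x d = 0 := fun c d x =>
    single_mul_single_of_ne c i l j hjl.symm d
  simp only [transvection, add_mul, mul_add, one_mul, mul_one, single_mul_single_same, h1, h2,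
    h3, h4, h5, add_zero, mul_neg, neg_mul, ← single_neg]
  abel

/-- In a monoid, two-sided inverses compose in the reverse order. [folklore] -/
theorem inv_pair {M : Type*} [Monoid M] {x x' y y' : M} (hx : x' * x = 1) (hx' : x * x' = 1)
    (hy : y' * y = 1) (hy' : y * y' = 1) :
    y' * x' * (x * y) = 1 ∧ x * y * (y' * x') = 1 := by
  constructor
  · calc y' * x' * (x * y) = y' * (x' * x) * y := by simp only [mul_assoc]
      _ = 1 := by rw [hx, mul_one, hy]
  · calc x * y * (y' * x') = x * (y * y') * x' := by simp only [mul_assoc]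
      _ = 1 := by rw [hy', mul_one, hx']

/-- The inverse word is a two-sided inverse: `winv⟦w⟧ · w = 1 = w · winv⟦w⟧` in `SL_3(k[x])`
(each letter `E_{ij}(c)` is inverted by `E_{ij}(-c)`, `i ≠ j`). [folklore] -/
theorem wprod_winv (w : List (Fin 3 × Fin 3 × k × Option σ)) (hw : ∀ l ∈ w, l.1 ≠ l.2.1) :
    wprod⟦winv⟦w⟧⟧ * wprod⟦w⟧ = 1 ∧ wprod⟦w⟧ * wprod⟦winv⟦w⟧⟧ = 1 := by
  induction w with
  | nil => simp
  | cons a w ih =>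
    have ha : a.1 ≠ a.2.1 := hw a (by simp)
    obtain ⟨ih₁, ih₂⟩ := ih fun l hl => hw l (by simp [hl])
    have h₁ : transvection a.1 a.2.1 (C (-a.2.2.1) * a.2.2.2.elim 1 X :
        MvPolynomial σ k) * transvection a.1 a.2.1 (C a.2.2.1 * a.2.2.2.elim 1 X) = 1 := by
      rw [transvection_mul_transvection_same _ _ ha, map_neg, neg_mul, neg_add_cancel,
        transvection_zero]
    have h₂ : transvection a.1 a.2.1 (C a.2.2.1 * a.2.2.2.elim 1 X : MvPolynomial σ k) *
        transvection a.1 a.2.1 (C (-a.2.2.1) * a.2.2.2.elim 1 X) = 1 := by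
      rw [transvection_mul_transvection_same _ _ ha, map_neg, neg_mul, add_neg_cancel,
        transvection_zero]
    simp only [List.map_cons, List.reverse_cons, List.map_append, List.map_nil, List.prod_append,
      List.prod_cons, List.prod_nil, mul_one]
    exact inv_pair h₁ h₂ ih₁ ih₂

/-- Monotonicity of the length bound. [folklore] -/
theorem hasWordAt_mono {i j : Fin 3} {g : MvPolynomial σ k} {m m' : ℕ} (h : HasWordAt[i, j, g, m])
    (hm : m ≤ m') : HasWordAt[i, j, g, m'] := by
  obtain ⟨w, hw, ho, hp⟩ := h
  exact ⟨w, hw.trans hm, ho, hp⟩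

/-- One letter `E_{ij}(c)` or `E_{ij}(c x_s)`. [folklore] -/
theorem hasWordAt_letter {i j : Fin 3} (hij : i ≠ j) (c : k) (o : Option σ) :
    HasWordAt[i, j, (C c * o.elim 1 X : MvPolynomial σ k), 1] :=
  ⟨[(i, j, c, o)], le_rfl, by simpa using hij, by simp⟩

/-- One constant letter `E_{ij}(c)`. [folklore] -/
theorem hasWordAt_C {i j : Fin 3} (hij : i ≠ j) (c : k) :
    HasWordAt[i, j, (C c : MvPolynomial σ k), 1] := by
  simpa using hasWordAt_letter hij c (none : Option σ)

/-- One variable letter `E_{ij}(c x_s)`. [folklore] -/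
theorem hasWordAt_C_mul_X {i j : Fin 3} (hij : i ≠ j) (c : k) (s : σ) :
    HasWordAt[i, j, (C c * X s : MvPolynomial σ k), 1] := by
  simpa using hasWordAt_letter hij c (some s)

/-- The letter `E_{ij}(1)`. [folklore] -/
theorem hasWordAt_one {i j : Fin 3} (hij : i ≠ j) : HasWordAt[i, j, (1 : MvPolynomial σ k), 1] := by
  simpa using hasWordAt_C hij (1 : k)

/-- **Sums are concatenations**: `E_{ij}(g₁) E_{ij}(g₂) = E_{ij}(g₁ + g₂)` (Ben-Or–Cleve 1992,
Thm. 1, the addition step). [folklore] -/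
theorem hasWordAt_add {i j : Fin 3} (hij : i ≠ j) {g₁ g₂ : MvPolynomial σ k} {m₁ m₂ : ℕ}
    (h₁ : HasWordAt[i, j, g₁, m₁]) (h₂ : HasWordAt[i, j, g₂, m₂]) :
    HasWordAt[i, j, g₁ + g₂, m₁ + m₂] := by
  obtain ⟨w₁, hw₁, ho₁, hp₁⟩ := h₁
  obtain ⟨w₂, hw₂, ho₂, hp₂⟩ := h₂
  refine ⟨w₁ ++ w₂, by simp only [List.length_append]; omega, ?_, ?_⟩
  · intro l hl
    rcases List.mem_append.1 hl with hl | hl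
    exacts [ho₁ l hl, ho₂ l hl]
  · rw [List.map_append, List.prod_append, hp₁, hp₂, transvection_mul_transvection_same _ _ hij]

/-- Sum of a list at a fixed position: lengths add. [folklore] -/
theorem hasWordAt_list_sum {i j : Fin 3} (hij : i ≠ j) {L : List (MvPolynomial σ k)} {b : ℕ}
    (h : ∀ g ∈ L, HasWordAt[i, j, g, b]) : HasWordAt[i, j, L.sum, L.length * b] := by
  induction L with
  | nil => simp
  | cons g L ih =>
    rw [List.sum_cons, List.length_cons, Nat.succ_mul, Nat.add_comm]
    exact hasWordAt_add hij (h g (by simp)) (ih fun q hq => h q (by simp [hq]))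

/-- Sum over a `Finset` at a fixed position: lengths add. [folklore] -/
theorem hasWordAt_finset_sum {i j : Fin 3} (hij : i ≠ j) {α : Type*} (s : Finset α)
    {g : α → MvPolynomial σ k} {b : ℕ} (h : ∀ a ∈ s, HasWordAt[i, j, g a, b]) :
    HasWordAt[i, j, ∑ a ∈ s, g a, s.card * b] := by
  induction s using Finset.cons_induction with
  | empty => simp
  | cons a s ha ih =>
    rw [Finset.sum_cons, Finset.card_cons, Nat.succ_mul, Nat.add_comm]
    exact hasWordAt_add hij (h a (by simp)) (ih fun q hq => h q (by simp [hq]))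

/-- **Products are commutators**: `E_{il}(fg) = E_{ij}(f) E_{jl}(g) E_{ij}(f)⁻¹ E_{jl}(g)⁻¹`
for distinct `i, j, l`, the inverses being the inverse words (Ben-Or–Cleve 1992, Thm. 1, the
multiplication step). [folklore] -/
theorem hasWordAt_mul {i j l : Fin 3} (hij : i ≠ j) (hjl : j ≠ l) (hil : i ≠ l)
    {f g : MvPolynomial σ k} {m₁ m₂ : ℕ} (hf : HasWordAt[i, j, f, m₁])
    (hg : HasWordAt[j, l, g, m₂]) : HasWordAt[i, l, f * g, 2 * m₁ + 2 * m₂] := by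
  obtain ⟨w₁, hw₁, ho₁, hp₁⟩ := hf
  obtain ⟨w₂, hw₂, ho₂, hp₂⟩ := hg
  refine ⟨w₁ ++ w₂ ++ winv⟦w₁⟧ ++ winv⟦w₂⟧, ?_, ?_, ?_⟩
  · simp only [List.length_append, List.length_reverse, List.length_map]
    omega
  · intro x hx
    simp only [List.mem_append, List.mem_reverse, List.mem_map] at hx
    rcases hx with ((hx | hx) | ⟨y, hy, rfl⟩) | ⟨y, hy, rfl⟩
    exacts [ho₁ x hx, ho₂ x hx, ho₁ y hy, ho₂ y hy]
  · have h₁ := wprod_winv w₁ ho₁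
    have h₂ := wprod_winv w₂ ho₂
    rw [hp₁] at h₁
    rw [hp₂] at h₂
    have e₁ : wprod⟦winv⟦w₁⟧⟧ = transvection i j (-f) :=
      left_inv_eq_right_inv h₁.1
        (by rw [transvection_mul_transvection_same _ _ hij, add_neg_cancel, transvection_zero])
    have e₂ : wprod⟦winv⟦w₂⟧⟧ = transvection j l (-g) :=
      left_inv_eq_right_inv h₂.1
        (by rw [transvection_mul_transvection_same _ _ hjl, add_neg_cancel, transvection_zero])
    simp only [List.map_append, List.prod_append]
    rw [hp₁, hp₂, e₁, e₂]
    exact transvection_comm hij hjl hil f g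

/-- The third index of `Fin 3`. [folklore] -/
theorem fin3_third {p q : Fin 3} (h : p ≠ q) : p ≠ -(p + q) ∧ -(p + q) ≠ q := by
  revert p q
  decide

/-- Products at every off-diagonal position (route the commutator through the third index).
[folklore] -/
theorem hasWordAt_mul_all {f g : MvPolynomial σ k} {m₁ m₂ : ℕ}
    (hf : ∀ p q : Fin 3, p ≠ q → HasWordAt[p, q, f, m₁])
    (hg : ∀ p q : Fin 3, p ≠ q → HasWordAt[p, q, g, m₂]) :
    ∀ p q : Fin 3, p ≠ q → HasWordAt[p, q, f * g, 2 * m₁ + 2 * m₂] := by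
  intro p q hpq
  obtain ⟨h₁, h₂⟩ := fin3_third hpq
  exact hasWordAt_mul h₁ h₂ hpq (hf _ _ h₁) (hg _ _ h₂)

/-- Product of a list at every off-diagonal position: `n` factors of length `≤ b` give length
`≤ 4ⁿ (b + 1)`. [folklore] -/
theorem hasWordAt_list_prod {T : List (MvPolynomial σ k)} {b : ℕ}
    (h : ∀ f ∈ T, ∀ p q : Fin 3, p ≠ q → HasWordAt[p, q, f, b]) :
    ∀ p q : Fin 3, p ≠ q → HasWordAt[p, q, T.prod, 4 ^ T.length * (b + 1)] := by
  induction T with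
  | nil =>
    intro p q hpq
    rw [List.prod_nil, List.length_nil, pow_zero, one_mul]
    exact hasWordAt_mono (hasWordAt_one hpq) (by omega)
  | cons f T ih =>
    intro p q hpq
    rw [List.prod_cons, List.length_cons]
    refine hasWordAt_mono
      (hasWordAt_mul_all (h f (by simp)) (ih fun g hg => h g (by simp [hg])) p q hpq) ?_
    have : 1 ≤ 4 ^ T.length := Nat.one_le_pow _ _ (by norm_num)
    rw [pow_succ]
    nlinarith

/-! ### Affine letters -/

/-- A monomial exponent of degree `≤ 1` is `0` or a single variable. [folklore] -/
theorem finsupp_eq_zero_or_eq_single (v : σ →₀ ℕ) (hv : v.degree ≤ 1) :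
    v = 0 ∨ ∃ s, v = Finsupp.single s 1 := by
  classical
  by_cases h0 : v = 0
  · exact Or.inl h0
  right
  obtain ⟨s, hs'⟩ := Finsupp.support_nonempty_iff.mpr h0
  have hs : v s ≠ 0 := Finsupp.mem_support_iff.mp hs'
  have hvs : v s = 1 :=
    le_antisymm ((Finsupp.le_degree s v).trans hv) (Nat.one_le_iff_ne_zero.2 hs)
  refine ⟨s, Finsupp.ext fun t => ?_⟩
  by_cases hts : t = s
  · subst hts
    simp [hvs]
  · rw [Finsupp.single_apply, if_neg (Ne.symm hts)]
    by_contra hvt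
    have h2 : v s + v t ≤ v.degree := by
      rw [Finsupp.degree_apply]
      calc v s + v t = ∑ x ∈ ({s, t} : Finset σ), v x := by rw [Finset.sum_pair (Ne.symm hts)]
        _ ≤ ∑ x ∈ v.support, v x := by
            refine Finset.sum_le_sum_of_subset fun x hx => ?_
            simp only [Finset.mem_insert, Finset.mem_singleton] at hx
            rcases hx with rfl | rfl
            · exact Finsupp.mem_support_iff.2 hs
            · exact Finsupp.mem_support_iff.2 hvt
    omega

/-- An affine linear form over finitely many variables is `a₀ + ∑ₛ aₛ xₛ` with its own
coefficients. [folklore] -/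
theorem eq_C_add_sum_of_totalDegree_le_one [Fintype σ] {a : MvPolynomial σ k}
    (ha : a.totalDegree ≤ 1) :
    a = C (coeff 0 a) + ∑ s : σ, C (coeff (Finsupp.single s 1) a) * X s := by
  classical
  ext v
  simp only [coeff_add, coeff_C, coeff_sum, coeff_C_mul, coeff_X]
  by_cases hv : v.degree ≤ 1
  · rcases finsupp_eq_zero_or_eq_single v hv with rfl | ⟨t, rfl⟩
    · simp
    · have h0 : (0 : σ →₀ ℕ) ≠ Finsupp.single t 1 := (Finsupp.single_ne_zero.2 one_ne_zero).symm
      simp [if_neg h0, Finsupp.single_left_inj (one_ne_zero)]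
  · have h0 : (0 : σ →₀ ℕ) ≠ v := by
      rintro rfl
      simp at hv
    have hs : ∀ s : σ, Finsupp.single s 1 ≠ v := by
      rintro s rfl
      simp at hv
    rw [coeff_eq_zero_of_totalDegree_lt (by rw [← Finsupp.degree_apply]; omega), if_neg h0]
    simp [hs]

/-- **Affine letters** (Ben-Or–Cleve 1992, the leaves): an affine linear form `a` over finitely
many variables has the word `E_{ij}(a₀) ∏ₛ E_{ij}(aₛ xₛ)` of length `#σ + 1`. [folklore] -/
theorem hasWordAt_of_totalDegree_le_one [Fintype σ] {i j : Fin 3} (hij : i ≠ j)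
    {a : MvPolynomial σ k} (ha : a.totalDegree ≤ 1) :
    HasWordAt[i, j, a, Fintype.card σ + 1] := by
  rw [eq_C_add_sum_of_totalDegree_le_one ha, Nat.add_comm]
  have hsum := hasWordAt_finset_sum hij (Finset.univ : Finset σ) (b := 1)
    (g := fun s => C (coeff (Finsupp.single s 1) a) * X s)
    (fun s _ => hasWordAt_C_mul_X hij _ s)
  rw [Finset.card_univ, Nat.mul_one] at hsum
  exact hasWordAt_add hij (hasWordAt_C hij _) hsum

end Words

end VpWordQp

end Summit.ValiantsHypothesis.ValiantsHypothesis.Theorems
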